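import Summits.Ventures.PercRepro.ThetaOmegaCoreAssembly

/-!
# Positions of the edges of a bad two-edge point relative to a T00 bad edge

Dossier proofs/MINE1-theoremS.md, Addendum 81 suppl. 2 (mine-1, gen 42). Let `(s, u = s + q)` be
a bad edge. The pair mechanisms at `q` built from any edge `(t, t + r)` of `F` in general position
force its colours to be consistent across the edge: `edge_c0_eq_of_mem` (`q ∈ t`),
`edge_c1_eq_of_notMem` (`q ∉ t`) — the lemmas L1 of `ThetaOmegaCorePair.lean` without the
badness of the edge. When the bad edge is of type T00 its two ends carry both colours in `c0` and
in `c1`, so the pair mechanisms at a bad two-edge point `r` built from `s, u` always fire and their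
`r`-edge must be `(∅, {r})`: this pins the position of each edge `(b, b + r)` of `r` relative to
`s` — `badTwo_inter_empty` (`q ∉ b`, `r ∈ s`: `b ∩ s = ∅`), `badTwo_subset` (`q ∉ b`, `r ∉ s`:
`b ⊆ s`), `badTwo_not_mem_of_notMem` (`q ∈ b`, `r ∉ s`: impossible), `badTwo_subset_insert`
(`q ∈ b`, `r ∈ s`: `s ⊆ b + r`).
-/

namespace PercRepro.MSTight

open Finset

variable {α : Type*} [DecidableEq α]

section EdgeL1

variable {q r : α} {U : Finset α} {F : Finset (Finset α)} {c0 c1 : Finset α → Bool}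
  {s t : Finset α}

/-- The pair mechanisms at a bad edge force any edge `(t, t + r)` of `F` in general position
containing `q` to be `c0`-consistent. -/
theorem edge_c0_eq_of_mem (hq : BadEdge U F c0 c1 q s) (ht : t ∈ F) (hvt : insert r t ∈ F)
    (hnd : NonDeg q s r t) (hqt : q ∈ t) : c0 t = c0 (insert r t) := by
  by_contra hne
  have hsF := hq.2.1
  have hqs := hq.2.2.1
  have huF := hq.2.2.2.1
  obtain ⟨hts, htu, hvs, hvu⟩ := hnd
  have hqv : q ∈ insert r t := mem_insert_of_mem hqt
  have hmemF : ∀ z, (z = t ∨ z = insert r t) → z ∈ F := by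
    rintro z (rfl | rfl)
    · exact ht
    · exact hvt
  have hmemq : ∀ z, (z = t ∨ z = insert r t) → q ∈ z := by
    rintro z (rfl | rfl)
    · exact hqt
    · exact hqv
  have hne_s : ∀ z, (z = t ∨ z = insert r t) → z ≠ s := by
    rintro z (rfl | rfl)
    · exact hts
    · exact hvs
  have hne_u : ∀ z, (z = t ∨ z = insert r t) → z ≠ insert q s := by
    rintro z (rfl | rfl)
    · exact htu
    · exact hvu
  by_cases hrs : r ∈ s
  · have heq : ∀ z, (z = t ∨ z = insert r t) → z \ insert q s = t \ insert q s := by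
      rintro z (rfl | rfl)
      · rfl
      · exact insert_sdiff_of_mem t (mem_insert_of_mem hrs)
    obtain ⟨x, hx, hxc⟩ := exists_of_ne c0 hne (c1 s)
    obtain ⟨y, hy, hyc⟩ := exists_of_ne c0 hne (c1 (insert q s))
    exact badEdge_not_mem_qEdges hq (qEdge_of_cross hsF hqs huF (hmemF x hx) (hmemq x hx) hxc
      (hmemF y hy) hyc ((heq x hx).trans (heq y hy).symm))
  · have heq : ∀ z, (z = t ∨ z = insert r t) → s ⊓ z = s ⊓ t := by
      rintro z (rfl | rfl)
      · rfl
      · exact inf_insert_of_notMem hrs t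
    obtain ⟨y, hy, hyc⟩ := exists_of_ne c0 hne (c0 s)
    obtain ⟨x, hx, hxc⟩ := exists_of_ne c0 hne (c0 (insert q s))
    exact badEdge_not_mem_qEdges hq (qEdge_of_inf_inf hsF hqs huF (hmemF y hy) (hne_s y hy) hyc
      (hmemF x hx) (hne_u x hx) hxc (hmemq x hx) ((heq y hy).trans (heq x hx).symm))

/-- The pair mechanisms at a bad edge force any edge `(t, t + r)` of `F` in general position
avoiding `q` to be `c1`-consistent. -/
theorem edge_c1_eq_of_notMem (hq : BadEdge U F c0 c1 q s) (hqr : q ≠ r) (ht : t ∈ F)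
    (hvt : insert r t ∈ F) (hnd : NonDeg q s r t) (hqt : q ∉ t) : c1 t = c1 (insert r t) := by
  by_contra hne
  have hqU := hq.1
  have hsF := hq.2.1
  have hqs := hq.2.2.1
  have huF := hq.2.2.2.1
  obtain ⟨hts, htu, hvs, hvu⟩ := hnd
  have hqv : q ∉ insert r t := by
    simp only [mem_insert, not_or]; exact ⟨hqr, hqt⟩
  have hmemF : ∀ z, (z = t ∨ z = insert r t) → z ∈ F := by
    rintro z (rfl | rfl)
    · exact ht
    · exact hvt
  have hmemq : ∀ z, (z = t ∨ z = insert r t) → q ∉ z := by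
    rintro z (rfl | rfl)
    · exact hqt
    · exact hqv
  have hne_s : ∀ z, (z = t ∨ z = insert r t) → z ≠ s := by
    rintro z (rfl | rfl)
    · exact hts
    · exact hvs
  have hne_u : ∀ z, (z = t ∨ z = insert r t) → z ≠ insert q s := by
    rintro z (rfl | rfl)
    · exact htu
    · exact hvu
  by_cases hrs : r ∈ s
  · have heq : ∀ z, (z = t ∨ z = insert r t) → s ⊔ z = s ⊔ t := by
      rintro z (rfl | rfl)
      · rfl
      · rw [sup_eq_union, union_insert, insert_eq_of_mem (mem_union_left t hrs), sup_eq_union]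
    obtain ⟨y, hy, hyc⟩ := exists_of_ne c1 hne (c1 s)
    obtain ⟨x, hx, hxc⟩ := exists_of_ne c1 hne (c1 (insert q s))
    exact badEdge_not_mem_qEdges_omegaC hq (qEdge_of_cojoin hqU hsF hqs huF (hmemF y hy)
      (hne_s y hy) hyc (hmemF x hx) (hne_u x hx) hxc (hmemq x hx)
      ((heq y hy).trans (heq x hx).symm))
  · have heq : ∀ z, (z = t ∨ z = insert r t) → s \ z = s \ t := by
      rintro z (rfl | rfl)
      · rfl
      · exact sdiff_insert_of_notMem hrs t
    obtain ⟨y, hy, hyc⟩ := exists_of_ne c1 hne (c0 s)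
    obtain ⟨x, hx, hxc⟩ := exists_of_ne c1 hne (c0 (insert q s))
    exact badEdge_not_mem_qEdges hq (qEdge_of_sdiff_sdiff hsF hqs huF (hmemF y hy) hyc.symm
      (hmemF x hx) hxc.symm (hmemq x hx) ((heq y hy).trans (heq x hx).symm))

end EdgeL1

section RSide

variable {q r : α} {U : Finset α} {F : Finset (Finset α)} {c0 c1 : Finset α → Bool}
  {s b : Finset α}

/-- The two members `s, s + q` of a T00 edge carry both colours; a member of a prescribed `c0`
colour among them. -/
theorem exists_c0_of_t00 (h : c0 s ≠ c0 (insert q s)) (d : Bool) :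
    ∃ y, (y = s ∨ y = insert q s) ∧ c0 y = d :=
  exists_of_ne c0 h d

/-- A member of a prescribed `c1` colour among `s, s + q`. -/
theorem exists_c1_of_t00 (h : c1 s ≠ c1 (insert q s)) (d : Bool) :
    ∃ y, (y = s ∨ y = insert q s) ∧ c1 y = d :=
  exists_of_ne c1 h d

/-- **`r` bad, `q ∉ b`, `r ∈ s`: `b ∩ s = ∅`** (the meet–meet mechanism at `r` from `s, s + q`). -/
theorem badTwo_inter_empty (hq : BadEdge U F c0 c1 q s) (h0 : c0 s ≠ c0 (insert q s))
    (hrA : ∀ d ∈ qEdges r (omegaA F c0 c1), d = ∅) (hb : b ∈ F) (hrb : r ∉ b)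
    (hvb : insert r b ∈ F) (hnd : NonDeg q s r b) (hqb : q ∉ b) (hrs : r ∈ s) : b ⊓ s = ∅ := by
  have hsF := hq.2.1
  have huF := hq.2.2.2.1
  obtain ⟨hbs, hbu, hvs, hvu⟩ := hnd
  have hmemF : ∀ z, (z = s ∨ z = insert q s) → z ∈ F := by
    rintro z (rfl | rfl)
    · exact hsF
    · exact huF
  have hmemr : ∀ z, (z = s ∨ z = insert q s) → r ∈ z := by
    rintro z (rfl | rfl)
    · exact hrs
    · exact mem_insert_of_mem hrs
  have heq : ∀ z, (z = s ∨ z = insert q s) → b ⊓ z = b ⊓ s := by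
    rintro z (rfl | rfl)
    · rfl
    · exact inf_insert_of_notMem hqb s
  have hne_b : ∀ z, (z = s ∨ z = insert q s) → z ≠ b := by
    rintro z (rfl | rfl)
    · exact Ne.symm hbs
    · exact Ne.symm hbu
  have hne_v : ∀ z, (z = s ∨ z = insert q s) → z ≠ insert r b := by
    rintro z (rfl | rfl)
    · exact Ne.symm hvs
    · exact Ne.symm hvu
  obtain ⟨y, hy, hyc⟩ := exists_c0_of_t00 h0 (c0 b)
  obtain ⟨x, hx, hxc⟩ := exists_c0_of_t00 h0 (c0 (insert r b))
  have hedge : b ⊓ y ∈ qEdges r (omegaA F c0 c1) := qEdge_of_inf_inf hb hrb hvb (hmemF y hy)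
    (hne_b y hy) hyc (hmemF x hx) (hne_v x hx) hxc (hmemr x hx) ((heq y hy).trans (heq x hx).symm)
  have := hrA _ hedge
  rw [heq y hy] at this
  exact this

/-- **`r` bad, `q ∉ b`, `r ∉ s`: `b ⊆ s`** (the difference–difference mechanism at `r`). -/
theorem badTwo_subset (hq : BadEdge U F c0 c1 q s) (h1 : c1 s ≠ c1 (insert q s)) (hqr : q ≠ r)
    (hrA : ∀ d ∈ qEdges r (omegaA F c0 c1), d = ∅) (hb : b ∈ F) (hrb : r ∉ b)
    (hvb : insert r b ∈ F) (hqb : q ∉ b) (hrs : r ∉ s) : b ⊆ s := by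
  have hsF := hq.2.1
  have huF := hq.2.2.2.1
  have hmemF : ∀ z, (z = s ∨ z = insert q s) → z ∈ F := by
    rintro z (rfl | rfl)
    · exact hsF
    · exact huF
  have hmemr : ∀ z, (z = s ∨ z = insert q s) → r ∉ z := by
    rintro z (rfl | rfl)
    · exact hrs
    · simp only [mem_insert, not_or]; exact ⟨Ne.symm hqr, hrs⟩
  have heq : ∀ z, (z = s ∨ z = insert q s) → b \ z = b \ s := by
    rintro z (rfl | rfl)
    · rfl
    · exact sdiff_insert_of_notMem hqb s
  obtain ⟨y, hy, hyc⟩ := exists_c1_of_t00 h1 (c0 b)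
  obtain ⟨x, hx, hxc⟩ := exists_c1_of_t00 h1 (c0 (insert r b))
  have hedge : b \ y ∈ qEdges r (omegaA F c0 c1) := qEdge_of_sdiff_sdiff hb hrb hvb (hmemF y hy)
    hyc.symm (hmemF x hx) hxc.symm (hmemr x hx) ((heq y hy).trans (heq x hx).symm)
  have := hrA _ hedge
  rw [heq y hy] at this
  exact sdiff_eq_empty_iff_subset.1 this

/-- **`r` bad, `q ∈ b`, `r ∉ s` is impossible** (the co-join mechanism at `r` gives an `r`-edge of
`C`). -/
theorem badTwo_not_mem_of_notMem (hq : BadEdge U F c0 c1 q s) (h1 : c1 s ≠ c1 (insert q s))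
    (hqr : q ≠ r) (hrU : r ∈ U) (hrC : ∀ d, d ∉ qEdges r (omegaC U F c1)) (hb : b ∈ F)
    (hrb : r ∉ b) (hvb : insert r b ∈ F) (hnd : NonDeg q s r b) (hqb : q ∈ b) (hrs : r ∉ s) :
    False := by
  have hsF := hq.2.1
  have huF := hq.2.2.2.1
  obtain ⟨hbs, hbu, hvs, hvu⟩ := hnd
  have hmemF : ∀ z, (z = s ∨ z = insert q s) → z ∈ F := by
    rintro z (rfl | rfl)
    · exact hsF
    · exact huF
  have hmemr : ∀ z, (z = s ∨ z = insert q s) → r ∉ z := by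
    rintro z (rfl | rfl)
    · exact hrs
    · simp only [mem_insert, not_or]; exact ⟨Ne.symm hqr, hrs⟩
  have heq : ∀ z, (z = s ∨ z = insert q s) → b ⊔ z = b ⊔ s := by
    rintro z (rfl | rfl)
    · rfl
    · rw [sup_eq_union, union_insert, insert_eq_of_mem (mem_union_left s hqb), sup_eq_union]
  have hne_b : ∀ z, (z = s ∨ z = insert q s) → z ≠ b := by
    rintro z (rfl | rfl)
    · exact Ne.symm hbs
    · exact Ne.symm hbu
  have hne_v : ∀ z, (z = s ∨ z = insert q s) → z ≠ insert r b := by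
    rintro z (rfl | rfl)
    · exact Ne.symm hvs
    · exact Ne.symm hvu
  obtain ⟨y, hy, hyc⟩ := exists_c1_of_t00 h1 (c1 b)
  obtain ⟨x, hx, hxc⟩ := exists_c1_of_t00 h1 (c1 (insert r b))
  exact hrC _ (qEdge_of_cojoin hrU hb hrb hvb (hmemF y hy) (hne_b y hy) hyc (hmemF x hx)
    (hne_v x hx) hxc (hmemr x hx) ((heq y hy).trans (heq x hx).symm))

/-- **`r` bad, `q ∈ b`, `r ∈ s`: `s ⊆ b + r`** (the cross-difference mechanism at `r`). -/
theorem badTwo_subset_insert (hq : BadEdge U F c0 c1 q s) (h0 : c0 s ≠ c0 (insert q s))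
    (hrA : ∀ d ∈ qEdges r (omegaA F c0 c1), d = ∅) (hb : b ∈ F) (hrb : r ∉ b)
    (hvb : insert r b ∈ F) (hqb : q ∈ b) (hrs : r ∈ s) : s ⊆ insert r b := by
  have hsF := hq.2.1
  have huF := hq.2.2.2.1
  have hmemF : ∀ z, (z = s ∨ z = insert q s) → z ∈ F := by
    rintro z (rfl | rfl)
    · exact hsF
    · exact huF
  have hmemr : ∀ z, (z = s ∨ z = insert q s) → r ∈ z := by
    rintro z (rfl | rfl)
    · exact hrs
    · exact mem_insert_of_mem hrs
  have heq : ∀ z, (z = s ∨ z = insert q s) → z \ insert r b = s \ insert r b := by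
    rintro z (rfl | rfl)
    · rfl
    · exact insert_sdiff_of_mem s (mem_insert_of_mem hqb)
  obtain ⟨x, hx, hxc⟩ := exists_c0_of_t00 h0 (c1 b)
  obtain ⟨y, hy, hyc⟩ := exists_c0_of_t00 h0 (c1 (insert r b))
  have hedge : y \ insert r b ∈ qEdges r (omegaA F c0 c1) := qEdge_of_cross hb hrb hvb (hmemF x hx)
    (hmemr x hx) hxc (hmemF y hy) hyc ((heq x hx).trans (heq y hy).symm)
  have := hrA _ hedge
  rw [heq y hy] at this
  exact sdiff_eq_empty_iff_subset.1 this

end RSide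

section SetIds

variable {r : α} {s b : Finset α}

/-- `s ⊓ b = s \ r` when `s ⊆ b + r` and `r ∉ b`. -/
theorem inf_insert_eq_erase_of_subset (hrb : r ∉ b) (hsub : s ⊆ insert r b) :
    s ⊓ b = s.erase r := by
  ext z
  simp only [inf_eq_inter, mem_inter, mem_erase]
  constructor
  · rintro ⟨hzs, hzb⟩
    exact ⟨fun h => hrb (h ▸ hzb), hzs⟩
  · rintro ⟨hzr, hzs⟩
    refine ⟨hzs, ?_⟩
    rcases mem_insert.1 (hsub hzs) with h | h
    · exact absurd h hzr
    · exact h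

/-- `s \ (b + r) = s \ r` when `b ⊓ s = ∅`. -/
theorem sdiff_insert_eq_erase_of_disjoint (hdis : b ⊓ s = ∅) : s \ insert r b = s.erase r := by
  ext z
  simp only [mem_sdiff, mem_insert, not_or, mem_erase]
  constructor
  · rintro ⟨hzs, hzr, hzb⟩
    exact ⟨hzr, hzs⟩
  · rintro ⟨hzr, hzs⟩
    refine ⟨hzs, hzr, fun hzb => ?_⟩
    have : z ∈ b ⊓ s := by simp only [inf_eq_inter, mem_inter]; exact ⟨hzb, hzs⟩
    rw [hdis] at this
    exact notMem_empty z this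

/-- `s ⊔ (b + r) = s + r` when `b ⊆ s`. -/
theorem sup_insert_eq_insert_of_subset (hsub : b ⊆ s) : s ⊔ insert r b = insert r s := by
  ext z
  simp only [sup_eq_union, mem_union, mem_insert]
  constructor
  · rintro (h | h | h)
    · exact Or.inr h
    · exact Or.inl h
    · exact Or.inr (hsub h)
  · rintro (h | h)
    · exact Or.inr (Or.inl h)
    · exact Or.inl h

end SetIds

end PercRepro.MSTight
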